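import Summits.CriticalPhenomena.CardyFormulaZ2.Theorems.CardyIKTransportCornerLineDescentDomainPerturbation
import Summits.CriticalPhenomena.CardyFormulaZ2.Theorems.CardyIKTransportCrudeToCanonical

/-!
# Stub `stub_countableApprox` (S1b) of crux `SubseqCardy` (stmt-CriticalPhenomena-5768), part 1 of 2:
# G02's bond-`ℤ²` crossing probability of a conformal rectangle is asymptotically the crude one

Route `CardyAnchoredRigidity`, sub-problem `CardyFormulaZ2`, line `registered`. This file proves the sub-goal
`stub_bondNearCrude`: for every conformal rectangle `R = (Ω; a, b, c, d)` and `ε > 0`, eventually as `δ → 0⁺`,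
`|bondDomainCrossingProb R δ - P_{1/2}[embDomainCrossing squareLatticeEmbedding.z Ω (δ/√2) (ab) (cd)]| ≤ ε`
(mesh-uniform asymptotic agreement of G02's discretisation with the crude embedded event; both one-sided halves of
the `DiscretisationBridge` reduction at once). Upper half: the exact inclusion `bondDomainCrossingProb_le_crude`.
Lower half: with `Φ` a square model of `R` and `A_τ (x + iy) = (1-τ)x + i(1+τ)y` (`exists_stretch`), the deformed
rectangle `R.map T_τ`, `T_τ = Φ ∘ A_τ ∘ Φ⁻¹`, pokes out of `Ω` across the arcs `0, 2` and keeps off the arcs `1, 3`: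
`deform_sandwich` puts it in the lower sandwich position of Bollobás–Riordan's Claim 19 port
(`crude_le_bondDomainCrossingProb` ∘ `stub_discreteCrossing_of_pathIn`), so `crude (R.map T_τ) (δ/√2) ≤ bond R δ`;
and `T_τ → id` uniformly near `closure Ω` (`deform_close`), so Schramm–Smirnov's mesh-uniform domain perturbation for
crude crossings (`stub_DomainPerturbation`, from `SchrammSmirnov2011_lemma_5_1_holds`) gives
`crude (R.map T_τ) ≥ crude R - ε` eventually. Plane topology + bookkeeping only; no definition, no named fact.

References: O. Schramm, S. Smirnov, Ann. Probab. 39 (2011) §5, Lemma 5.1 and eq. (5.1); B. Bollobás, O. Riordan,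
*Percolation* (2006), Ch. 7 Lemma 14 p. 184, Claim 19 p. 192.
-/

noncomputable section

namespace Summit.CriticalPhenomena.CardyFormulaZ2.Cruxes.SubseqCardy.Birth

open Set Filter Topology Metric MeasureTheory
open Literature.Probability.RandomPlanarGeometry (ConformalRectangle MarkedDomain)
open Literature.Probability.Percolation (IsSquareModel exists_isSquareModel unitSquareQuad unitSquareQuad_carrier
  bondDomainCrossingProb)
open Summit.CriticalPhenomena.CardyFormulaZ2.Theorems (crude_le_bondDomainCrossingProb
  bondDomainCrossingProb_le_crude tendsto_div_sqrt_two)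
open Summit.CriticalPhenomena.CardyFormulaZ2.Theorems.CornerLineDescent.SymmetricSeed (bondStdCrossingProb
  stub_DomainPerturbation)
open Summit.CriticalPhenomena.CardyFormulaZ2.Theorems.CornerLineDescent.SymmetricSeed.Freeze (exists_gap
  exists_modulus)
open Summit.CriticalPhenomena.CardyFormulaZ2.Cruxes.LoopsToCrossings.OracleSandwich
  (stub_discreteCrossing_of_pathIn)

namespace CountableApprox

/-- **Axis stretches are plane homeomorphisms**: for `a, b ≠ 0` there is a homeomorphism `A` of `ℂ` with
`A (x + iy) = a·x + i·b·y` (two homotheties of `ℝ`, conjugated by `ℂ ≃L[ℝ] ℝ × ℝ`). [folklore] -/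
theorem exists_stretch (a b : ℝ) (ha : a ≠ 0) (hb : b ≠ 0) :
    ∃ A : ℂ ≃ₜ ℂ, ∀ z : ℂ, (A z).re = a * z.re ∧ (A z).im = b * z.im := by
  refine ⟨Complex.equivRealProdCLM.toHomeomorph.trans
    (((Homeomorph.mulLeft₀ a ha).prodCongr (Homeomorph.mulLeft₀ b hb)).trans
      Complex.equivRealProdCLM.toHomeomorph.symm), fun z => ⟨?_, ?_⟩⟩ <;> simp

/-- Images under the conjugate `Φ ∘ A ∘ Φ⁻¹` of a plane homeomorphism `A` by a chart `Φ`, read in the chart.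
[folklore] -/
theorem image_conj (Φ A : ℂ ≃ₜ ℂ) (X : Set ℂ) :
    (Φ.symm.trans (A.trans Φ)) '' X = (fun w => Φ (A w)) '' (Φ.symm '' X) := by
  rw [image_image]; rfl

/-- A point of the closed `r`-thickening of the continuous image of a compact set is within `r` of the image of
a point of the set. [folklore] -/
theorem exists_near_of_mem_cthickening {K : Set ℂ} (hK : IsCompact K) {F : ℂ → ℂ} (hF : Continuous F)
    {r : ℝ} (hr : 0 ≤ r) {z : ℂ} (hz : z ∈ cthickening r (F '' K)) : ∃ w ∈ K, dist z (F w) ≤ r := by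
  rw [(hK.image hF).cthickening_eq_biUnion_closedBall hr, mem_iUnion₂] at hz
  obtain ⟨x, ⟨w, hw, rfl⟩, hzx⟩ := hz
  exact ⟨w, hw, mem_closedBall.1 hzx⟩

section Model

variable {R : ConformalRectangle} {Φ : ℂ ≃ₜ ℂ} (hΦ : IsSquareModel R Φ)
include hΦ

/-- In a square model, the chart preimage of the domain is the open model square. [folklore] -/
theorem symm_image_carrier : Φ.symm '' R.carrier = unitSquareQuad.carrier := by
  rw [← hΦ.image_carrier, Homeomorph.image_symm, Φ.injective.preimage_image]

/-- In a square model, the chart preimage of the arc `i` is the side `i` of the model square. [folklore] -/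
theorem symm_image_arc (i : Fin 4) : Φ.symm '' R.arc i = unitSquareQuad.arc i := by
  rw [← hΦ.image_arc i, Homeomorph.image_symm, Φ.injective.preimage_image]

/-- The arcs of the deformed rectangle `R.map (Φ ∘ A ∘ Φ⁻¹)` are the `Φ ∘ A`-images of the sides. [folklore] -/
theorem arc_map_conj (A : ℂ ≃ₜ ℂ) (i : Fin 4) :
    (R.map (Φ.symm.trans (A.trans Φ))).arc i = (fun w => Φ (A w)) '' unitSquareQuad.arc i := by
  rw [MarkedDomain.arc_map, image_conj, symm_image_arc hΦ]

/-- The closed deformed rectangle is the `Φ ∘ A`-image of the closed square. [folklore] -/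
theorem closure_carrier_map_conj (A : ℂ ≃ₜ ℂ) :
    closure (R.map (Φ.symm.trans (A.trans Φ))).carrier =
      (fun w => Φ (A w)) '' (Icc (-1 : ℝ) 1 ×ℂ Icc (-1 : ℝ) 1) := by
  rw [MarkedDomain.carrier_map, image_conj, symm_image_carrier hΦ, unitSquareQuad_carrier,
    show (fun w => Φ (A w)) = ⇑(A.trans Φ) from rfl, ← Homeomorph.image_closure, Complex.closure_reProdIm,
    closure_Ioo (by norm_num)]

/-- **The squeezed image is in lower sandwich position.** For a plate margin `t > 0` there is `τ₀ > 0` such that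
for `0 < τ ≤ τ₀` and every squeeze `A = A_τ`, the deformed rectangle `Q = R.map (Φ ∘ A ∘ Φ⁻¹)` satisfies, for some
room `r > 0` and lateral margin `m > 0`, the four position clauses of `crude_le_bondDomainCrossingProb`: points of
the `r`-neighbourhood of `Q` outside `Ω` are `t`-close to `arc 0` or `arc 2`, points of it are `m`-far from the arcs
`1, 3`, and the `r`-neighbourhoods of `Q.arc 0`, `Q.arc 2` lie outside `Ω`, `t`-close to `R.arc 0`, `R.arc 2`
(compact–closed gaps in the chart, uniform continuity of `Φ` on `[-2, 2]²`).
[cite: BollobasRiordan2006, Ch. 7 Lemma 14 p. 184] -/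
theorem deform_sandwich {t : ℝ} (ht : 0 < t) :
    ∃ τ₀ : ℝ, 0 < τ₀ ∧ τ₀ < 1 ∧ ∀ τ : ℝ, 0 < τ → τ < 1 → τ ≤ τ₀ → ∀ A : ℂ ≃ₜ ℂ,
      (∀ z : ℂ, (A z).re = (1 - τ) * z.re ∧ (A z).im = (1 + τ) * z.im) →
      ∃ r : ℝ, 0 < r ∧ ∃ m : ℝ, 0 < m ∧
      (∀ z ∈ cthickening r (R.map (Φ.symm.trans (A.trans Φ))).carrier, z ∉ R.carrier →
          infDist z (R.arc 0) ≤ t ∨ infDist z (R.arc 2) ≤ t) ∧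
      (∀ z ∈ cthickening r (R.map (Φ.symm.trans (A.trans Φ))).carrier, z ∈ R.carrier →
          m ≤ infDist z (R.arc 1) ∧ m ≤ infDist z (R.arc 3)) ∧
      (∀ z ∈ cthickening r ((R.map (Φ.symm.trans (A.trans Φ))).arc 0),
          z ∉ R.carrier ∧ infDist z (R.arc 0) ≤ t) ∧
      (∀ z ∈ cthickening r ((R.map (Φ.symm.trans (A.trans Φ))).arc 2),
          z ∉ R.carrier ∧ infDist z (R.arc 2) ≤ t) := by
  obtain ⟨θ, hθ, hmod⟩ := exists_modulus Φ (half_pos ht)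
  refine ⟨min θ (1 / 2), lt_min hθ one_half_pos, (min_le_right _ _).trans_lt (by norm_num),
    fun τ h0 h1 hτ A hA => ?_⟩
  have hτθ : τ ≤ θ := hτ.trans (min_le_left _ _)
  have hτ2 : τ ≤ 1 / 2 := hτ.trans (min_le_right _ _)
  set F : ℂ → ℂ := fun w => Φ (A w) with hF
  have hFc : Continuous F := Φ.continuous.comp A.continuous
  set B : Set ℂ := Icc (-1 : ℝ) 1 ×ℂ Icc (-1 : ℝ) 1 with hB
  have hBc : IsCompact B := isCompact_Icc.reProdIm isCompact_Icc
  have hclU : closure unitSquareQuad.carrier = Icc (-1 : ℝ) 1 ×ℂ Icc (-1 : ℝ) 1 := by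
    rw [unitSquareQuad_carrier, Complex.closure_reProdIm, closure_Ioo (by norm_num)]
  have harcB : ∀ i : Fin 4, unitSquareQuad.arc i ⊆ B := fun i =>
    (unitSquareQuad.arc_subset_frontier i).trans (frontier_subset_closure.trans hclU.subset)
  -- the sides `0` / `2` of the model square are `im = -1` / `im = 1`
  have hside : ∀ (i : Fin 4) (σ : ℝ), (i = 0 ∧ σ = -1 ∨ i = 2 ∧ σ = 1) → ∀ p : ℂ,
      p ∈ unitSquareQuad.arc i ↔ p.im = σ ∧ p.re ∈ Icc (-1 : ℝ) 1 := by
    rintro i σ (⟨rfl, rfl⟩ | ⟨rfl, rfl⟩) p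
    exacts [Literature.Probability.Percolation.SquareModel.mem_arc_zero,
      Literature.Probability.Percolation.SquareModel.mem_arc_two]
  -- coordinates of squeezed points of the closed square
  have hAre : ∀ w ∈ B, (A w).re ∈ Icc (-(1 - τ)) (1 - τ) := fun w hw => by
    have h := (Complex.mem_reProdIm.1 hw).1
    rw [(hA w).1]
    exact ⟨by nlinarith [h.1, h.2], by nlinarith [h.1, h.2]⟩
  have hAim : ∀ w ∈ B, -(1 + τ) ≤ (A w).im ∧ (A w).im ≤ 1 + τ := fun w hw => by
    have h := (Complex.mem_reProdIm.1 hw).2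
    rw [(hA w).2]
    exact ⟨by nlinarith [h.1, h.2], by nlinarith [h.1, h.2]⟩
  have hsq2 : ∀ w ∈ B, A w ∈ Icc (-2 : ℝ) 2 ×ℂ Icc (-2 : ℝ) 2 := fun w hw => by
    obtain ⟨a1, a2⟩ := hAre w hw
    obtain ⟨b1, b2⟩ := hAim w hw
    exact Complex.mem_reProdIm.2 ⟨⟨by linarith, by linarith⟩, ⟨by linarith, by linarith⟩⟩
  -- gaps: squeezed sides `0 ∪ 2` vs the closed domain; squeezed middle vs `Ωᶜ`; squeezed square vs arcs `1 ∪ 3`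
  obtain ⟨g₀, hg₀, hgap₀⟩ : ∃ g : ℝ, 0 < g ∧ ∀ k ∈ F '' (unitSquareQuad.arc 0 ∪ unitSquareQuad.arc 2),
      ∀ l ∈ closure R.carrier, g < dist k l := by
    refine exists_gap (((unitSquareQuad.isCompact_arc 0).union (unitSquareQuad.isCompact_arc 2)).image hFc)
      isClosed_closure (Set.disjoint_left.2 ?_)
    rintro _ ⟨w, hw, rfl⟩ hx
    rw [← hΦ.image_Icc] at hx
    obtain ⟨b, hb, hbx⟩ := hx
    have hb' := (Complex.mem_reProdIm.1 hb).2
    rw [Φ.injective hbx, (hA w).2] at hb'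
    rcases hw with hw | hw
    · rw [((hside 0 (-1) (Or.inl ⟨rfl, rfl⟩) w).1 hw).1] at hb'; linarith [hb'.1]
    · rw [((hside 2 1 (Or.inr ⟨rfl, rfl⟩) w).1 hw).1] at hb'; linarith [hb'.2]
  obtain ⟨g₁, hg₁, hgap₁⟩ : ∃ g : ℝ, 0 < g ∧
      ∀ k ∈ Φ '' (Icc (-(1 - τ)) (1 - τ) ×ℂ Icc (-(1 - τ)) (1 - τ)), ∀ l ∈ R.carrierᶜ, g < dist k l := by
    refine exists_gap ((isCompact_Icc.reProdIm isCompact_Icc).image Φ.continuous) R.isOpen.isClosed_compl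
      (Set.disjoint_compl_right_iff_subset.2 ?_)
    rw [← hΦ.image_carrier, unitSquareQuad_carrier]
    refine image_mono fun w hw => ?_
    obtain ⟨⟨a1, a2⟩, ⟨b1, b2⟩⟩ := Complex.mem_reProdIm.1 hw
    exact Complex.mem_reProdIm.2 ⟨⟨by linarith, by linarith⟩, ⟨by linarith, by linarith⟩⟩
  obtain ⟨g₃, hg₃, hgap₃⟩ : ∃ g : ℝ, 0 < g ∧ ∀ k ∈ F '' B, ∀ l ∈ R.arc 1 ∪ R.arc 3, g < dist k l := by
    refine exists_gap (hBc.image hFc) ((R.isClosed_arc 1).union (R.isClosed_arc 3)) (Set.disjoint_left.2 ?_)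
    rintro _ ⟨w, hw, rfl⟩ hx
    obtain ⟨a1, a2⟩ := hAre w hw
    rcases hx with hx | hx
    · rw [← hΦ.image_arc 1] at hx
      obtain ⟨p, hp, hpx⟩ := hx
      have := (Literature.Probability.Percolation.SquareModel.mem_arc_one.1 hp).1
      rw [Φ.injective hpx] at this
      linarith
    · rw [← hΦ.image_arc 3] at hx
      obtain ⟨p, hp, hpx⟩ := hx
      have := (Literature.Probability.Percolation.SquareModel.mem_arc_three.1 hp).1
      rw [Φ.injective hpx] at this
      linarith
  -- the room `r` and the lateral margin `g₃ / 2`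
  set r : ℝ := min (min g₀ (min g₁ (g₃ / 2))) (t / 2) with hr
  have hr0 : 0 < r := by positivity
  have hrg₀ : r ≤ g₀ := (min_le_left _ _).trans (min_le_left _ _)
  have hrg₁ : r ≤ g₁ := (min_le_left _ _).trans ((min_le_right _ _).trans (min_le_left _ _))
  have hrg₃ : r ≤ g₃ / 2 := (min_le_left _ _).trans ((min_le_right _ _).trans (min_le_right _ _))
  have hrt : r ≤ t / 2 := min_le_right _ _
  have hcl : closure (R.map (Φ.symm.trans (A.trans Φ))).carrier = F '' B := closure_carrier_map_conj hΦ A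
  -- a chart point squeezed `τ`-close to the side `i ∈ {0, 2}` has `F w` `t/2`-close to `R.arc i`
  have knear : ∀ (i : Fin 4) (σ : ℝ), (i = 0 ∧ σ = -1 ∨ i = 2 ∧ σ = 1) → ∀ w ∈ B, |(A w).im - σ| ≤ τ →
      ∀ z : ℂ, dist z (F w) ≤ r → infDist z (R.arc i) ≤ t := by
    intro i σ hiσ w hw hle z hzw
    have hwre := (Complex.mem_reProdIm.1 hw).1
    have hre' : (1 - τ) * w.re ∈ Icc (-1 : ℝ) 1 := ⟨by nlinarith [hwre.1, hwre.2], by nlinarith [hwre.1, hwre.2]⟩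
    have hσ : σ ∈ Icc (-2 : ℝ) 2 := by
      rcases hiσ with ⟨-, rfl⟩ | ⟨-, rfl⟩ <;> exact ⟨by norm_num, by norm_num⟩
    have hfoot : (⟨(1 - τ) * w.re, σ⟩ : ℂ) ∈ Icc (-2 : ℝ) 2 ×ℂ Icc (-2 : ℝ) 2 :=
      Complex.mem_reProdIm.2 ⟨⟨by simp only; linarith [hre'.1], by simp only; linarith [hre'.2]⟩, hσ⟩
    have hΦw' : Φ ⟨(1 - τ) * w.re, σ⟩ ∈ R.arc i := by
      rw [← hΦ.image_arc i]
      exact mem_image_of_mem Φ ((hside i σ hiσ _).2 ⟨rfl, hre'⟩)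
    have hd : dist (F w) (Φ ⟨(1 - τ) * w.re, σ⟩) ≤ t / 2 := by
      refine hmod _ (hsq2 w hw) _ hfoot ?_
      rw [Complex.dist_of_re_eq (by rw [(hA w).1]), Real.dist_eq]
      exact hle.trans hτθ
    calc infDist z (R.arc i) ≤ dist z (Φ ⟨(1 - τ) * w.re, σ⟩) := infDist_le_dist_of_mem hΦw'
      _ ≤ dist z (F w) + dist (F w) (Φ ⟨(1 - τ) * w.re, σ⟩) := dist_triangle _ _ _
      _ ≤ t := by linarith
  -- (L3)/(L4): the `r`-neighbourhood of `Q.arc i`, `i ∈ {0, 2}`, lies outside `Ω`, `t`-close to `R.arc i`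
  have kout : ∀ (i : Fin 4) (σ : ℝ), (i = 0 ∧ σ = -1 ∨ i = 2 ∧ σ = 1) →
      ∀ z ∈ cthickening r ((R.map (Φ.symm.trans (A.trans Φ))).arc i),
        z ∉ R.carrier ∧ infDist z (R.arc i) ≤ t := by
    intro i σ hiσ z hz
    rw [arc_map_conj hΦ A i] at hz
    obtain ⟨w, hw, hzw⟩ := exists_near_of_mem_cthickening (unitSquareQuad.isCompact_arc i) hFc hr0.le hz
    have hw02 : w ∈ unitSquareQuad.arc 0 ∪ unitSquareQuad.arc 2 := by
      rcases hiσ with ⟨rfl, -⟩ | ⟨rfl, -⟩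
      exacts [Or.inl hw, Or.inr hw]
    have hwim : (A w).im = (1 + τ) * σ := by rw [(hA w).2, ((hside i σ hiσ w).1 hw).1]
    refine ⟨fun hzR => ?_, knear i σ hiσ w (harcB i hw) ?_ z hzw⟩
    · have := hgap₀ (F w) (mem_image_of_mem F hw02) z (subset_closure hzR)
      rw [dist_comm] at hzw
      linarith
    · rw [hwim]
      rcases hiσ with ⟨-, rfl⟩ | ⟨-, rfl⟩
      · rw [show (1 + τ) * (-1 : ℝ) - -1 = -τ by ring, abs_neg, abs_of_pos h0]
      · rw [show (1 + τ) * (1 : ℝ) - 1 = τ by ring, abs_of_pos h0]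
  refine ⟨r, hr0, g₃ / 2, by positivity, ?_, ?_, kout 0 (-1) (Or.inl ⟨rfl, rfl⟩), kout 2 1 (Or.inr ⟨rfl, rfl⟩)⟩
  · -- (L1) points near `Q` outside `Ω` are `t`-close to `arc 0` or `arc 2`
    intro z hz hzR
    rw [← cthickening_closure, hcl] at hz
    obtain ⟨w, hw, hzw⟩ := exists_near_of_mem_cthickening hBc hFc hr0.le hz
    obtain ⟨b1, b2⟩ := hAim w hw
    by_cases him : |(A w).im| ≤ 1 - τ
    · exfalso
      have hAM : A w ∈ Icc (-(1 - τ)) (1 - τ) ×ℂ Icc (-(1 - τ)) (1 - τ) :=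
        Complex.mem_reProdIm.2 ⟨hAre w hw, abs_le.1 him⟩
      have := hgap₁ (F w) (mem_image_of_mem Φ hAM) z hzR
      rw [dist_comm] at hzw
      linarith
    · push Not at him
      rcases le_or_gt 0 (A w).im with hpos | hneg
      · rw [abs_of_nonneg hpos] at him
        exact Or.inr (knear 2 1 (Or.inr ⟨rfl, rfl⟩) w hw (abs_le.2 ⟨by linarith, by linarith⟩) z hzw)
      · rw [abs_of_neg hneg] at him
        exact Or.inl (knear 0 (-1) (Or.inl ⟨rfl, rfl⟩) w hw (abs_le.2 ⟨by linarith, by linarith⟩) z hzw)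
  · -- (L2) points near `Q` are `g₃/2`-far from the arcs `1`, `3`
    intro z hz _
    rw [← cthickening_closure, hcl] at hz
    obtain ⟨w, hw, hzw⟩ := exists_near_of_mem_cthickening hBc hFc hr0.le hz
    have key : ∀ l ∈ R.arc 1 ∪ R.arc 3, g₃ / 2 ≤ dist z l := fun l hl => by
      have h1' := hgap₃ (F w) (mem_image_of_mem F hw) l hl
      have h2' : dist (F w) l ≤ dist z (F w) + dist z l := by
        rw [dist_comm z (F w)]
        exact dist_triangle _ _ _
      linarith
    exact ⟨(le_infDist ⟨_, R.pt_mem_arc_self 1⟩).2 fun l hl => key l (Or.inl hl),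
      (le_infDist ⟨_, R.pt_mem_arc_self 3⟩).2 fun l hl => key l (Or.inr hl)⟩

end Model

/-- **The deformation tends to the identity uniformly on compacta** as `τ → 0⁺`: on a compact `K`, the conjugate
`Φ ∘ A_τ ∘ Φ⁻¹` of the squeeze `A_τ (x + iy) = (1-τ)x + i(1+τ)y` moves points by at most `η` once
`τ ≤ τ₁(Φ, K, η)` (`Φ` is uniformly continuous on a large disc containing `Φ⁻¹(K)`, and `|A_τ w - w| ≤ 2τ|w|`).
[folklore] -/
theorem deform_close (Φ : ℂ ≃ₜ ℂ) {K : Set ℂ} (hK : IsCompact K) {η : ℝ} (hη : 0 < η) :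
    ∃ τ₁ : ℝ, 0 < τ₁ ∧ τ₁ < 1 ∧ ∀ τ : ℝ, 0 < τ → τ ≤ τ₁ → ∀ A : ℂ ≃ₜ ℂ,
      (∀ z : ℂ, (A z).re = (1 - τ) * z.re ∧ (A z).im = (1 + τ) * z.im) →
      ∀ z ∈ K, dist ((Φ.symm.trans (A.trans Φ)) z) z ≤ η := by
  obtain ⟨M₀, hM₀⟩ := (hK.image Φ.symm.continuous).isBounded.exists_norm_le
  set M : ℝ := max M₀ 0 with hMdef
  have hM : 0 ≤ M := le_max_right _ _
  obtain ⟨θ, hθ, huc⟩ := Metric.uniformContinuousOn_iff.1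
    ((isCompact_closedBall (0 : ℂ) (M + 1)).uniformContinuousOn_of_continuous Φ.continuous.continuousOn) η hη
  refine ⟨min (1 / 2) (min θ 1 / (2 * (M + 1))), by positivity,
    (min_le_left _ _).trans_lt (by norm_num), fun τ h0 hτ A hA z hz => ?_⟩
  set w := Φ.symm z with hw
  have hwM : ‖w‖ ≤ M := (hM₀ w (mem_image_of_mem _ hz)).trans (le_max_left _ _)
  have hc : τ * (2 * (M + 1)) ≤ min θ 1 := (le_div_iff₀ (by positivity)).1 (hτ.trans (min_le_right _ _))
  have hid : 2 * τ * M = τ * (2 * (M + 1)) - 2 * τ := by ring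
  have hθ' : 2 * τ * M < θ := by linarith [min_le_left θ 1]
  have h1' : 2 * τ * M ≤ 1 := by linarith [min_le_right θ 1]
  have hd : dist (A w) w ≤ 2 * τ * M := by
    rw [dist_eq_norm]
    refine (Complex.norm_le_abs_re_add_abs_im _).trans ?_
    rw [Complex.sub_re, Complex.sub_im, (hA w).1, (hA w).2,
      show (1 - τ) * w.re - w.re = -(τ * w.re) by ring, show (1 + τ) * w.im - w.im = τ * w.im by ring,
      abs_neg, abs_mul, abs_mul, abs_of_pos h0]
    have := Complex.abs_re_le_norm w
    have := Complex.abs_im_le_norm w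
    nlinarith
  have hwL : w ∈ closedBall (0 : ℂ) (M + 1) := mem_closedBall_zero_iff.2 (by linarith)
  have hAwL : A w ∈ closedBall (0 : ℂ) (M + 1) := by
    rw [mem_closedBall_zero_iff]
    calc ‖A w‖ = ‖w + (A w - w)‖ := by rw [add_sub_cancel]
      _ ≤ ‖w‖ + ‖A w - w‖ := norm_add_le _ _
      _ ≤ M + 1 := by rw [← dist_eq_norm]; linarith
  have key := huc (A w) hAwL w hwL (hd.trans_lt hθ')
  have hz' : Φ w = z := Φ.apply_symm_apply z
  calc dist ((Φ.symm.trans (A.trans Φ)) z) z = dist (Φ (A w)) (Φ w) := by rw [hz']; rfl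
    _ ≤ η := key.le

end CountableApprox

/-- **Sub-goal `stub_bondNearCrude` of stub S1b — G02's crossing probability is asymptotically the crude one**:
for every conformal rectangle `R` and `ε > 0`, eventually as `δ → 0⁺`,
`|bondDomainCrossingProb R δ - P_{1/2}[embDomainCrossing squareLatticeEmbedding.z R.carrier (δ/√2) (R.arc 0) (R.arc 2)]| ≤ ε`.
Upper half: `bondDomainCrossingProb_le_crude`. Lower half: the squeezed image `R.map (Φ ∘ A_τ ∘ Φ⁻¹)` is in lower
sandwich position (`deform_sandwich`), so its crude probability at `δ/√2` is at most `bond R δ` by the Claim 19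
port (`crude_le_bondDomainCrossingProb`, `stub_discreteCrossing_of_pathIn`), while the deformation is uniformly
close to the identity near `closure Ω` (`deform_close`), so its crude probabilities differ from those of `R` by
at most `ε` for small meshes (`stub_DomainPerturbation`, Schramm–Smirnov (5.1)).
[cite: SchrammSmirnov2011, §5 Lemma 5.1 and eq. (5.1)] [cite: BollobasRiordan2006, Ch. 7 Claim 19 p. 192] -/
theorem stub_bondNearCrude : ∀ (R : Literature.Probability.RandomPlanarGeometry.ConformalRectangle) (ε : ℝ), 0 < ε → ∀ᶠ δ in nhdsWithin (0 : ℝ) (Set.Ioi 0), |Literature.Probability.Percolation.bondDomainCrossingProb R δ - (Literature.Probability.Percolation.bondPercolation (Literature.Probability.LatticeModels.zdGraph 2) Literature.Probability.Percolation.half).real (Literature.Probability.Percolation.embDomainCrossing Literature.Probability.LatticeModels.squareLatticeEmbedding.z R.carrier (δ / Real.sqrt 2) (R.arc 0) (R.arc 2))| ≤ ε := by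
  intro R ε hε
  obtain ⟨η, hη, hpert⟩ := stub_DomainPerturbation R ε hε
  obtain ⟨Φ, hΦ⟩ := exists_isSquareModel R
  obtain ⟨δA, hδA, tA, htA, hA⟩ := stub_discreteCrossing_of_pathIn R
  obtain ⟨τ₀, hτ₀, hτ₀1, hsand⟩ := CountableApprox.deform_sandwich hΦ htA
  obtain ⟨τ₁, hτ₁, -, hclose⟩ :=
    CountableApprox.deform_close Φ (R.isBounded.isCompact_closure.cthickening (r := 1)) hη
  have h0 : 0 < min τ₀ τ₁ := lt_min hτ₀ hτ₁
  have h1 : min τ₀ τ₁ < 1 := (min_le_left _ _).trans_lt hτ₀1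
  -- the squeeze `A_τ` at `τ = min τ₀ τ₁` and its conjugate `Φ ∘ A_τ ∘ Φ⁻¹`
  obtain ⟨A, hAs⟩ := CountableApprox.exists_stretch (1 - min τ₀ τ₁) (1 + min τ₀ τ₁) (by linarith) (by linarith)
  obtain ⟨r, hr, m, hm, hL1, hL2, hL3, hL4⟩ := hsand (min τ₀ τ₁) h0 h1 (min_le_left _ _) A hAs
  have hev : ∀ᶠ δ in 𝓝[>] (0 : ℝ),
      |bondStdCrossingProb (R.map (Φ.symm.trans (A.trans Φ))) (δ / Real.sqrt 2) -
        bondStdCrossingProb R (δ / Real.sqrt 2)| ≤ ε :=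
    tendsto_div_sqrt_two.eventually (hpert _ (hclose _ h0 (min_le_right _ _) A hAs))
  have hsmall : ∀ᶠ δ in 𝓝[>] (0 : ℝ), δ < min (min δA m) (r / 2) :=
    mem_nhdsWithin_of_mem_nhds (Iio_mem_nhds (lt_min (lt_min hδA hm) (half_pos hr)))
  have hpos : ∀ᶠ δ in 𝓝[>] (0 : ℝ), 0 < δ := self_mem_nhdsWithin
  filter_upwards [hpos, hev, hsmall] with δ hδ hε' h2
  have hδA' : δ < δA := h2.trans_le ((min_le_left _ _).trans (min_le_left _ _))
  have hδm : δ < m := h2.trans_le ((min_le_left _ _).trans (min_le_right _ _))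
  have hδr : Real.sqrt 2 * δ < r := by
    have h22 : Real.sqrt 2 < 2 := Real.sqrt_two_lt_three_halves.trans (by norm_num)
    have : δ < r / 2 := h2.trans_le (min_le_right _ _)
    nlinarith
  have hlow := crude_le_bondDomainCrossingProb R hA hL1 hL2 hL3 hL4 hδ hδA' hδm hδr htA.le le_rfl
  have hup := bondDomainCrossingProb_le_crude R hδ
  simp only [bondStdCrossingProb] at hε'
  rw [abs_le] at hε' ⊢
  constructor <;> linarith [hε'.1, hε'.2]

end Summit.CriticalPhenomena.CardyFormulaZ2.Cruxes.SubseqCardy.Birth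

end
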